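import Mathlib
import Literature.MathematicalPhysics.QuantumFieldTheory.Balaban1983to89.B9Ineq347
import Literature.MathematicalPhysics.QuantumFieldTheory.Balaban1983to89.B6RandomWalkHom

/-!
# `Balaban1983to89.B9Ineq347AllEntries` — B9 p. 398 *"the global inequalities (3.47) are consequences of the local ones
(3.42) and Lemma 2.1"*, kernel-checked for ALL FOUR ENTRIES, with the weights (L^jη)^γ of (3.41) identified for real γ

statement-level skeleton of published theorems with citation tags; proofs where landed; nothing here is a claim about the Yang–Mills mass gap

T. Bałaban, *Propagators for lattice gauge theories in a background field*, Commun. Math. Phys. **99**, 389–434 (1985)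
[Balaban1985BackgroundPropagators] (cell paper B9; held `paper:balaban1985-cmp99-background-propagators`, journal page =
PDF page + 388; quotations below read from the renders `b2b-balaban-ref1/pages/…-p009-x2.png`, `…-p010-x2.png` =
pp. 397–398); its reference [4] = T. Bałaban,
*Propagators and renormalization transformations for lattice gauge theories. II*, Commun. Math. Phys. **96**, 223–250
(1984) [Balaban1984PropagatorsII].

SIBLINGS REUSED BY NAME (imported, nothing restated or modified): `…B9Ineq347` (unit b09 g2: `ScaleTransfer`,
`scaleTransfer_of_260`, `glob347_entry1_of_342` = the FIRST entry of (3.47) for endomorphisms of ONE function space; its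
header lists as NOT REPRODUCED *"(i) the other three entries of (3.47) … once ∇_UG′, G′∇*_U, Δ_UG′ are read as operators
between the appropriate function spaces"* and *"(iii) the identification of the typed weight w with (L^jη)^γ for REAL γ"*,
and leaves the ℕ-reading of (2.60) *"to the instantiating seat"*), `…B6RandomWalkHom` (unit pv21 g2: the TWO-SPACE
majorant shape `HasMajorantHom blkX blkY T K` — *"|(Tλ)(v)| ≦ K(y,y′)|λ| for v in the block of y, supp λ ⊂ Δ(y′)"* —
whose header lists (3.47) under *"(iv) … NOT REPRODUCED"*), `…B6RandomWalk` (unit pv08: `BlockSupp`, `blockPiece`,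
`sum_blockPiece`, (2.60)/(2.61) named `Ineq260`/`Ineq261`), `…B9Thm34Ext` (`toB6`: a B9 geometry read as a [4]
geometry), `…B9` (`B9.Geometry`, `Geometry.len` = L^jη, `B9.pref4` = the bracket [(L^jη)², L^jη, L^jη, 1] of (3.42)).

THE PRINTED STEP (verbatim).  p. 397 [PDF 9]: *"Besides the above norms we will use also weighted norms, connected with
the sequence of domains {Ω_j}. We define for an arbitrary real number α |A|_{(α)} = sup_{0≦j≦k} sup_{b∈Ω_j∖Ω_{j+1}}
(L^jη)^{−α}|A(b)|. (3.41) Thus the norm |A|_{(α)} can be defined as the smallest number C such, that |A(b)| ≦ C(L^jη)^α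
for b ∈ Ω_j∖Ω_{j+1}, j = 0, 1, …, k."* (render p009); Theorem 3.1, (3.42) p. 397: *"|(G′(U)λ)(x)|, |(∇_UG′(U)λ)(x)|,
|(G′(U)∇\*_Uλ)(x)|, |(Δ_UG′(U)λ)(x)| ≦ B₀[(L^jη)², L^jη, L^jη, 1]e^{−δ₀d(y,y′)}|λ| for x ∈ Δ(y), y ∈ Λ_j, supp λ ⊂
Δ(y′);"*; (3.47) p. 398 [PDF 10] (render p010): *"and the global inequalities |G′(U)λ|_{(2+γ)}, |∇_UG′(U)λ|_{(1+γ)},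
|G′(U)∇\*_Uλ|_{(1+γ)}, |∇_UG′(U)λ|_{(γ)} ≦ B₀|λ|_{(γ)} (3.47) for γ in a fixed compact subset of real numbers, e.g. for
γ ∈ [−4, 4]."* (the fourth left member, printed «|∇_UG′(U)λ|_{(γ)}», is the Δ_UG′ entry of (3.42) — census G-B9-01;
below the four operators are abstract anyway); and the two sentences after Theorem 3.1, p. 398: *"Next, the choice of powers L^jη is conventional also. Using Lemma 2.1
in [4] we may replace the factor (L^jη)^α by (L^jη)^β(L^{j′}η)^γ with β + γ = α, j, j′ are indices of localizations. It
is easy to see that the global inequalities (3.47) are consequences of the local ones (3.42) and Lemma 2.1."*  "Lemma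
2.1 in [4]" = [Balaban1984PropagatorsII] p. 234: (2.60) *"e^{−αδ₀d(y,y′)} ≦ e^{−αδ₀RM max{|j−j′|−1,0}}, y ∈ Λ_j,
y′ ∈ Λ_{j′}"*, (2.61) *"sup_{y∈𝔅} Σ_{y′∈𝔅} e^{−αδ₀d(y,y′)} ≦ c₁(α)"*.

WHAT IS REPRODUCED (0 sorry, theorems only; every analytic input a hypothesis OF THE PRINTED SHAPE, named):
(a) `glob347_of_342_hom` — **(3.42)_n ⇒ (3.47)_n for an operator T between TWO function spaces** (input lattice X with
  block map `blkX`, output lattice Y with `blkY`; e.g. T = ∇_UG′(U): site functions → bond functions): if T has the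
  two-space majorant B₀P(y)e^{−δ₀d(y,y′)} (P ≥ 0 arbitrary — P(y) = (L^jη)², L^jη, L^jη, 1 are the four entries),
  (2.61) holds at the exponent 1 − α and the scale transfer `ScaleTransfer g δ₀ α C w` (e^{−αδ₀d(y,y′)}w(y′) ≦ C·w(y)),
  then |λ(x)| ≦ w(y′)N on Δ(y′) for all y′ implies |(Tλ)(v)| ≦ B₀c₁(1−α)C·P(y)w(y)·N for v in the block of y.  Route =
  the printed one: λ = Σ_{y′}Δ(y′)λ on the INPUT lattice, (3.42)_n block by block, e^{−δ₀d} = e^{−(1−α)δ₀d}·e^{−αδ₀d},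
  scale transfer, (2.61).  (For X = Y, blkX = blkY this is `B9Ineq347.glob347_entry1_of_342` — `glob347_of_342_end`.)
(b) `weight_ratio` — the weight of (3.41) IDENTIFIED: w(y) = (L^{j(y)}η)^γ, γ real; for L ≥ 1, η > 0:
  w(y′) ≦ (L^{|γ|})^{|j−j′|}·w(y) — the hypothesis `hratio` of `B9Ineq347.scaleTransfer_of_260` DISCHARGED; and
  `pref4_mul_rpow`: [(L^jη)², L^jη, L^jη, 1]_n·(L^jη)^γ = (L^jη)^{[2,1,1,0]_n + γ} (the exponents 2+γ, 1+γ, 1+γ, γ of (3.47)).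
(c) `h260_nat_of_Ineq260` — pv08's typed (2.60) (`B6RandomWalk.Ineq260 (toB6 g R H) δ₀ α`, real exponent
  αδ₀RM·max{|j−j′|−1,0}) ⇒ the ℕ-shape e^{−αδ₀d(y,y′)} ≦ q^{|j−j′|−1}, q = e^{−αδ₀RM}, |j−j′| = `Nat.dist`, used by
  `scaleTransfer_of_260`.
(d) `rpow_abs_mul_exp_le_one` — the LOCATED size condition of the scale transfer: |γ|·log L ≦ αδ₀RM ⇒ L^{|γ|}e^{−αδ₀RM} ≦ 1;
  uniform on the printed compact set: 4·log L ≦ αδ₀RM suffices for every γ ∈ [−4, 4] (`size_condition_compact`).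
(e) `glob347_of_342_weighted` — (a) + (b) + (c) + (d) assembled for ONE entry: under (3.42)_n (two-space majorant),
  (2.60), (2.61) at 1 − α, L ≥ 1, η > 0 and |γ|log L ≦ αδ₀RM: |(Tλ)(v)| ≦ B₀c₁(1−α)L^{|γ|}·P(y)(L^jη)^γ·N whenever
  |λ(x)| ≦ (L^{j′}η)^γ N on Δ(y′) — i.e. |Tλ|_{(p+γ)} ≦ B₀(γ)|λ|_{(γ)} with B₀(γ) = B₀c₁(1−α)L^{|γ|};
  `glob347_allEntries` — THE FOUR ENTRIES AT ONCE for a family T_n (n : Fin 4) between carriers X_n → Y_n with the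
  (3.42) majorants B₀·[(L^jη)², L^jη, L^jη, 1]_n·e^{−δ₀d(y,y′)}: for every γ ∈ [−4, 4], under 4 log L ≦ αδ₀RM,
  |(T_nλ)(v)| ≦ B₀c₁(1−α)L⁴·[(L^jη)², L^jη, L^jη, 1]_n(L^jη)^γ·|λ|_{(γ)} — ONE constant B₀c₁(1−α)L⁴ "dependent on d and L
  only" for γ in the compact set, as printed.
WHAT IS *NOT* REPRODUCED OR ASSERTED: (3.42) itself (hypothesis `h342`, the two-space majorant shape of `B6RandomWalkHom`);
Lemma 2.1 of [4] for the geometry at hand ((2.60)/(2.61) are the hypotheses `h260`/`h261` in pv08's typed form — (2.61)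
with the PRINTED c₁(α) = `B6.c1 d δ₀ α`, d a free parameter, cf. the constant discussion in `…B6RandomWalkHom`); the
identification of the abstract `Loc`-level Prop `B9.Ineq342_346_347`/`B9FromB6.GlobBlock` with functions X → ℝ (those
carriers are not tied to functions; as in `…B9Ineq347` the dictionary is this docstring); the region reading of (3.41)
(b ∈ Ω_j∖Ω_{j+1} ↦ the scale j(y′(b)) of the block containing b — the block maps `blkX`, `blkY` ARE that reading).
NOTHING of the series' end-statement is asserted; value = kernel-checked bookkeeping of a printed "It is easy to see",
NOT summit progress.  Cell `lit-balaban`, Phase-2 seat p27 gen 7 (free target G.5-34(d)); SKELETON row B9.Thm3.1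
(member: (3.42) ⇒ (3.47), all entries).
-/

namespace Literature.MathematicalPhysics.QuantumFieldTheory.Balaban1983to89.B9Ineq347AllEntries

open Literature.MathematicalPhysics.QuantumFieldTheory.Balaban1983to89
open B6RandomWalk B6RandomWalkHom B9Ineq347

/-! ## (a) (3.42)_n ⇒ (3.47)_n between two function spaces -/

section Glob

variable {g : B9.Geometry} [Fintype g.Site] {R : ℝ} {H : Prop} {X Y : Type}

/-- **"It is easy to see that the global inequalities (3.47) are consequences of the local ones (3.42) and Lemma 2.1"
(p. 398) — ANY entry, operators between TWO function spaces, constants explicit.**  If T : (X → ℝ) → (Y → ℝ) has the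
(3.42)_n two-space majorant B₀P(y)e^{−δ₀d(y,y′)} (v in the block of y ⟺ `blkY v = y`, supp λ ⊂ Δ(y′) ⟺ λ vanishes off
`blkX ⁻¹ {y′}`; P(y) = (L^jη)², L^jη, L^jη, 1 for n = 1, 2, 3, 4, any P ≥ 0), Lemma 2.1 (2.61) of [4] holds at the
exponent 1 − α and the scale transfer at the exponent α with constant C, then for every λ with |λ(x)| ≤ w(y′)N for
x ∈ Δ(y′) (N ≥ 0, i.e. |λ|_{(γ)} ≤ N for w = (L^jη)^γ):  |(Tλ)(v)| ≤ B₀c₁(1−α)C·P(y)w(y)N for v in the block of y —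
i.e. |Tλ|_{(p+γ)} ≤ B₀(γ)|λ|_{(γ)} with B₀(γ) = B₀c₁(1−α)C.  Route: λ = Σ_{y′}Δ(y′)λ on the input lattice, (3.42)_n block
by block, e^{−δ₀d} = e^{−(1−α)δ₀d}e^{−αδ₀d}, scale transfer, (2.61).
[cite: Balaban1985BackgroundPropagators, (3.42) p.397 + (3.47) and the sentence after it p.398] -/
theorem glob347_of_342_hom (blkX : X → g.Site) (blkY : Y → g.Site) (d : ℕ) (δ₀ α B₀ C N : ℝ) (P w : g.Site → ℝ)
    (hB₀ : 0 ≤ B₀) (hP : ∀ y, 0 ≤ P y) (hw : ∀ y, 0 ≤ w y) (hN : 0 ≤ N)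
    (h261 : Ineq261 d (B9Thm34Ext.toB6 g R H) δ₀ (1 - α)) (hST : ScaleTransfer g δ₀ α C w)
    {T : (X → ℝ) →ₗ[ℝ] (Y → ℝ)}
    (h342 : HasMajorantHom (g := B9Thm34Ext.toB6 g R H) blkX blkY T
      (fun a b => B₀ * P a * Real.exp (-(δ₀ * g.dist a b))))
    (μ : X → ℝ) (hμ : ∀ x, |μ x| ≤ w (blkX x) * N) (v : Y) :
    |T μ v| ≤ B₀ * B6.c1 d δ₀ (1 - α) * C * P (blkY v) * w (blkY v) * N := by
  -- (3.42)_n on each block piece Δ(y′)λ of the INPUT lattice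
  have hpiece : ∀ y' : g.Site,
      |T (blockPiece (g := B9Thm34Ext.toB6 g R H) blkX y' μ) v| ≤
        B₀ * P (blkY v) * Real.exp (-(δ₀ * g.dist (blkY v) y')) * (w y' * N) := fun y' =>
    h342 y' _ _ (blockSupp_blockPiece (g := B9Thm34Ext.toB6 g R H) blkX μ y' (w y' * N)
      (mul_nonneg (hw _) hN) (fun x' hx' => by rw [← hx']; exact hμ x')) v
  -- λ = Σ_{y′} Δ(y′)λ and linearity
  have hsum : T μ v = ∑ y' : g.Site, T (blockPiece (g := B9Thm34Ext.toB6 g R H) blkX y' μ) v := by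
    conv_lhs => rw [← sum_blockPiece (g := B9Thm34Ext.toB6 g R H) blkX μ, map_sum, Finset.sum_apply]
    rfl
  -- splitting of the exponential
  have hsplit : ∀ y' : g.Site, Real.exp (-(δ₀ * g.dist (blkY v) y')) =
      Real.exp (-((1 - α) * δ₀ * g.dist (blkY v) y')) * Real.exp (-(α * δ₀ * g.dist (blkY v) y')) := by
    intro y'
    rw [← Real.exp_add]
    congr 1
    ring
  have hK : 0 ≤ B₀ * P (blkY v) * N := mul_nonneg (mul_nonneg hB₀ (hP _)) hN
  calc |T μ v| = |∑ y' : g.Site, T (blockPiece (g := B9Thm34Ext.toB6 g R H) blkX y' μ) v| := by rw [hsum]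
    _ ≤ ∑ y' : g.Site, |T (blockPiece (g := B9Thm34Ext.toB6 g R H) blkX y' μ) v| :=
        Finset.abs_sum_le_sum_abs _ _
    _ ≤ ∑ y' : g.Site, B₀ * P (blkY v) * Real.exp (-(δ₀ * g.dist (blkY v) y')) * (w y' * N) :=
        Finset.sum_le_sum fun y' _ => hpiece y'
    _ = B₀ * P (blkY v) * N * ∑ y' : g.Site, Real.exp (-((1 - α) * δ₀ * g.dist (blkY v) y')) *
          (Real.exp (-(α * δ₀ * g.dist (blkY v) y')) * w y') := by
        rw [Finset.mul_sum]
        refine Finset.sum_congr rfl fun y' _ => ?_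
        rw [hsplit y']
        ring
    _ ≤ B₀ * P (blkY v) * N * ∑ y' : g.Site, Real.exp (-((1 - α) * δ₀ * g.dist (blkY v) y')) * (C * w (blkY v)) := by
        refine mul_le_mul_of_nonneg_left (Finset.sum_le_sum fun y' _ => ?_) hK
        exact mul_le_mul_of_nonneg_left (hST (blkY v) y') (Real.exp_nonneg _)
    _ = B₀ * P (blkY v) * N * (C * w (blkY v)) *
          ∑ y' : g.Site, Real.exp (-((1 - α) * δ₀ * g.dist (blkY v) y')) := by
        rw [← Finset.sum_mul]
        ring
    _ ≤ B₀ * P (blkY v) * N * (C * w (blkY v)) * B6.c1 d δ₀ (1 - α) := by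
        refine mul_le_mul_of_nonneg_left (h261 (blkY v)) ?_
        have hC : 0 ≤ C * w (blkY v) :=
          le_trans (mul_nonneg (Real.exp_nonneg _) (hw _)) (hST (blkY v) (blkY v))
        exact mul_nonneg hK hC
    _ = B₀ * B6.c1 d δ₀ (1 - α) * C * P (blkY v) * w (blkY v) * N := by ring

/-- Bookkeeping: for ONE function space (X = Y) the two-space theorem IS b09's `B9Ineq347.glob347_entry1_of_342` read
through `B6RandomWalkHom.hasMajorantHom_iff` — nothing new for entry 1. [cite: Balaban1985BackgroundPropagators, (3.47) p.398] -/
theorem glob347_of_342_end (blk : X → g.Site) (d : ℕ) (δ₀ α B₀ C N : ℝ) (P w : g.Site → ℝ)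
    (hB₀ : 0 ≤ B₀) (hP : ∀ y, 0 ≤ P y) (hw : ∀ y, 0 ≤ w y) (hN : 0 ≤ N)
    (h261 : Ineq261 d (B9Thm34Ext.toB6 g R H) δ₀ (1 - α)) (hST : ScaleTransfer g δ₀ α C w)
    {G : Module.End ℝ (X → ℝ)}
    (h342 : HasMajorant (g := B9Thm34Ext.toB6 g R H) blk G (fun a b => B₀ * P a * Real.exp (-(δ₀ * g.dist a b))))
    (μ : X → ℝ) (hμ : ∀ x, |μ x| ≤ w (blk x) * N) (x : X) :
    |G μ x| ≤ B₀ * B6.c1 d δ₀ (1 - α) * C * P (blk x) * w (blk x) * N :=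
  glob347_of_342_hom (R := R) (H := H) blk blk d δ₀ α B₀ C N P w hB₀ hP hw hN h261 hST
    ((hasMajorantHom_iff (g := B9Thm34Ext.toB6 g R H) blk G _).2 h342) μ hμ x

end Glob

/-! ## (b) The weight (L^jη)^γ of (3.41), γ real -/

section Weight

variable (g : B9.Geometry)

/-- L^jη > 0 for L > 0, η > 0. [folklore] -/
private theorem len_pos (hL : 0 < g.L) (hη : 0 < g.eta) (y : g.Site) : 0 < g.len y :=
  mul_pos (pow_pos hL _) hη

/-- For L ≥ 1 and natural j, j′ and real γ: (L^{j′})^γ ≤ L^{|γ|·|j−j′|}·(L^{j})^γ. [folklore] -/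
private theorem pow_rpow_le (L γ : ℝ) (hL : 1 ≤ L) (j j' : ℕ) :
    (L ^ j') ^ γ ≤ (L ^ |γ|) ^ (Nat.dist j j') * (L ^ j) ^ γ := by
  have hL0 : 0 < L := lt_of_lt_of_le one_pos hL
  have h1 : (L ^ j') ^ γ = L ^ ((j' : ℝ) * γ) := by
    rw [← Real.rpow_natCast, ← Real.rpow_mul hL0.le]
  have h2 : (L ^ j) ^ γ = L ^ ((j : ℝ) * γ) := by
    rw [← Real.rpow_natCast, ← Real.rpow_mul hL0.le]
  have h3 : (L ^ |γ|) ^ (Nat.dist j j') = L ^ (|γ| * (Nat.dist j j' : ℝ)) := by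
    rw [← Real.rpow_natCast, ← Real.rpow_mul hL0.le]
  rw [h1, h2, h3, ← Real.rpow_add hL0]
  apply Real.rpow_le_rpow_of_exponent_le hL
  -- (j′ − j)γ ≤ |γ|·|j − j′|
  have hd : ((j' : ℝ) - j) * γ ≤ |γ| * (Nat.dist j j' : ℝ) := by
    have hdist : |(j' : ℝ) - j| ≤ (Nat.dist j j' : ℝ) := by
      rcases le_total j j' with hjj | hjj
      · rw [Nat.dist_eq_sub_of_le hjj, Nat.cast_sub hjj, abs_of_nonneg (by
          have : (j : ℝ) ≤ j' := by exact_mod_cast hjj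
          linarith)]
      · rw [Nat.dist_eq_sub_of_le_right hjj, Nat.cast_sub hjj, abs_of_nonpos (by
          have : (j' : ℝ) ≤ j := by exact_mod_cast hjj
          linarith)]
        linarith
    calc ((j' : ℝ) - j) * γ ≤ |((j' : ℝ) - j) * γ| := le_abs_self _
      _ = |γ| * |(j' : ℝ) - j| := by rw [abs_mul, mul_comm]
      _ ≤ |γ| * (Nat.dist j j' : ℝ) := mul_le_mul_of_nonneg_left hdist (abs_nonneg _)
  linarith

/-- **The weight of (3.41) identified.**  With w(y) = (L^{j(y)}η)^γ (the weight of the scaled supremum norm |·|_{(γ)},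
p. 397: *"|A(b)| ≦ C(L^jη)^α for b ∈ Ω_j∖Ω_{j+1}"*), γ an arbitrary REAL number, L ≥ 1, η > 0: the weight changes by at
most a factor L^{|γ|} per scale step, w(y′) ≤ (L^{|γ|})^{|j(y)−j(y′)|}·w(y) — the hypothesis `hratio` of
`B9Ineq347.scaleTransfer_of_260` for this weight. [cite: Balaban1985BackgroundPropagators, (3.41) p.397] -/
theorem weight_ratio (hL : 1 ≤ g.L) (hη : 0 < g.eta) (γ : ℝ) (y y' : g.Site) :
    (g.len y') ^ γ ≤ (g.L ^ |γ|) ^ (Nat.dist (g.scale y) (g.scale y')) * (g.len y) ^ γ := by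
  have hL0 : 0 < g.L := lt_of_lt_of_le one_pos hL
  unfold B9.Geometry.len
  rw [Real.mul_rpow (pow_nonneg hL0.le _) hη.le, Real.mul_rpow (pow_nonneg hL0.le _) hη.le, ← mul_assoc]
  exact mul_le_mul_of_nonneg_right (pow_rpow_le g.L γ hL _ _) (Real.rpow_nonneg hη.le _)

/-- The weight (L^jη)^γ is nonnegative (L > 0, η > 0). [cite: Balaban1985BackgroundPropagators, (3.41) p.397] -/
theorem weight_nonneg (hL : 0 < g.L) (hη : 0 < g.eta) (γ : ℝ) (y : g.Site) : 0 ≤ (g.len y) ^ γ :=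
  Real.rpow_nonneg (len_pos g hL hη y).le _

/-- The bracket of (3.42) times the weight of (3.41): [(L^jη)², L^jη, L^jη, 1]_n·(L^jη)^γ = (L^jη)^{[2,1,1,0]_n + γ} —
the exponents 2 + γ, 1 + γ, 1 + γ, γ of the four left members of (3.47) (t = L^jη > 0).
[cite: Balaban1985BackgroundPropagators, (3.42) p.397 + (3.47) p.398] -/
theorem pref4_mul_rpow (t γ : ℝ) (ht : 0 < t) (n : Fin 4) :
    B9.pref4 t n * t ^ γ = t ^ ((![2, 1, 1, 0] : Fin 4 → ℝ) n + γ) := by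
  fin_cases n
  · show t ^ 2 * t ^ γ = t ^ ((2 : ℝ) + γ)
    rw [Real.rpow_add ht, Real.rpow_two]
  · show t * t ^ γ = t ^ ((1 : ℝ) + γ)
    rw [Real.rpow_add ht, Real.rpow_one]
  · show t * t ^ γ = t ^ ((1 : ℝ) + γ)
    rw [Real.rpow_add ht, Real.rpow_one]
  · show (1 : ℝ) * t ^ γ = t ^ ((0 : ℝ) + γ)
    rw [one_mul, zero_add]

/-- The bracket of (3.42) is nonnegative for t = L^jη ≥ 0. [cite: Balaban1985BackgroundPropagators, (3.42) p.397] -/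
theorem pref4_nonneg (t : ℝ) (ht : 0 ≤ t) (n : Fin 4) : 0 ≤ B9.pref4 t n := by
  fin_cases n
  · exact pow_nonneg ht 2
  · exact ht
  · exact ht
  · exact zero_le_one

end Weight

/-! ## (c) (2.60) of [4] in the ℕ-exponent shape -/

section From260

variable (g : B9.Geometry) [Fintype g.Site] (R : ℝ) (H : Prop)

/-- For natural j, j′: the printed real number max{|j − j′| − 1, 0} of (2.60) is the natural number |j − j′| − 1
(truncated subtraction, |j − j′| = `Nat.dist j j′`). [folklore] -/
private theorem max_abs_sub_one_eq (j j' : ℕ) :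
    max (|(j : ℝ) - j'| - 1) 0 = ((Nat.dist j j' - 1 : ℕ) : ℝ) := by
  have habs : |(j : ℝ) - j'| = (Nat.dist j j' : ℝ) := by
    rcases le_total j j' with hjj | hjj
    · rw [Nat.dist_eq_sub_of_le hjj, Nat.cast_sub hjj, abs_of_nonpos (by
        have : (j : ℝ) ≤ j' := by exact_mod_cast hjj
        linarith)]
      ring
    · rw [Nat.dist_eq_sub_of_le_right hjj, Nat.cast_sub hjj, abs_of_nonneg (by
        have : (j' : ℝ) ≤ j := by exact_mod_cast hjj
        linarith)]
  rw [habs]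
  rcases Nat.eq_zero_or_pos (Nat.dist j j') with h0 | hpos
  · rw [h0]
    simp
  · rw [Nat.cast_sub hpos, Nat.cast_one, max_eq_left]
    have : (1 : ℝ) ≤ (Nat.dist j j' : ℝ) := by exact_mod_cast hpos
    linarith

/-- **(2.60) of [4], typed by pv08 with the printed real exponent αδ₀RM·max{|j−j′|−1, 0} for the transported geometry
`toB6 g R H`, in the ℕ-exponent shape consumed by `B9Ineq347.scaleTransfer_of_260`**: e^{−αδ₀d(y,y′)} ≤ q^{|j−j′|−1}
with q = e^{−αδ₀RM} and |j − j′| = `Nat.dist (j y) (j y′)` — the identification b09 left *"to the instantiating seat"*.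
[cite: Balaban1984PropagatorsII, (2.60) p.234] -/
theorem h260_nat_of_Ineq260 (δ₀ α : ℝ) (h260 : Ineq260 (B9Thm34Ext.toB6 g R H) δ₀ α) (y y' : g.Site) :
    Real.exp (-(α * δ₀ * g.dist y y')) ≤
      Real.exp (-(α * δ₀ * R * g.M)) ^ (Nat.dist (g.scale y) (g.scale y') - 1) := by
  have h := h260 y y'
  simp only [B9Thm34Ext.toB6_dist, B9Thm34Ext.toB6_R, B9Thm34Ext.toB6_M, B9Thm34Ext.toB6_scale] at h
  rw [max_abs_sub_one_eq] at h
  refine h260_of_Ineq260_shape (α * δ₀ * R * g.M) (α * δ₀ * g.dist y y') _ ?_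
  convert h using 3

end From260

/-! ## (d) The located size condition of the scale transfer -/

section Size

/-- **The size condition made a number.**  The scale transfer needs Λq ≤ 1 with Λ = L^{|γ|} (one factor per scale step)
and q = e^{−αδ₀RM} ((2.60)): for L > 0 this is |γ|·log L ≤ αδ₀RM — a condition of the kind (2.59) of [4] (*"RM is
sufficiently large"*), uniform for γ in a compact set, which is why the print restricts γ to one.
[cite: Balaban1985BackgroundPropagators, p.398 remark after (3.47); Balaban1984PropagatorsII, (2.59)–(2.60) pp.233–234] -/
theorem rpow_abs_mul_exp_le_one (L γ a : ℝ) (hL : 0 < L) (h : |γ| * Real.log L ≤ a) :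
    L ^ |γ| * Real.exp (-a) ≤ 1 := by
  rw [Real.rpow_def_of_pos hL, ← Real.exp_add]
  have : Real.log L * |γ| + -a ≤ 0 := by nlinarith
  calc Real.exp (Real.log L * |γ| + -a) ≤ Real.exp 0 := Real.exp_le_exp.2 this
    _ = 1 := Real.exp_zero

/-- Λ = L^{|γ|} ≥ 1 for L ≥ 1. [folklore] -/
private theorem one_le_rpow_abs (L γ : ℝ) (hL : 1 ≤ L) : 1 ≤ L ^ |γ| :=
  Real.one_le_rpow hL (abs_nonneg γ)

/-- **Uniformity on the printed compact set** *"e.g. for γ ∈ [−4, 4]"*: for L ≥ 1 and |γ| ≤ 4 the single condition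
4·log L ≤ αδ₀RM implies the size condition |γ|·log L ≤ αδ₀RM of every such γ, and the factor L^{|γ|} is at most L⁴ —
hence ONE constant B₀c₁(1−α)L⁴ in (3.47) for the whole compact set. [cite: Balaban1985BackgroundPropagators, (3.47) p.398] -/
theorem size_condition_compact (L γ a : ℝ) (hL : 1 ≤ L) (hγ : |γ| ≤ 4) (h : 4 * Real.log L ≤ a) :
    |γ| * Real.log L ≤ a ∧ L ^ |γ| ≤ L ^ (4 : ℝ) := by
  refine ⟨?_, Real.rpow_le_rpow_of_exponent_le hL hγ⟩
  have hlog : 0 ≤ Real.log L := Real.log_nonneg hL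
  nlinarith [abs_nonneg γ]

end Size

/-! ## (e) The assembled global inequalities -/

section Assembled

variable {g : B9.Geometry} [Fintype g.Site] {R : ℝ} {H : Prop} {X Y : Type}

/-- **(3.47)_n from (3.42)_n with the weight (L^jη)^γ and the located size condition — one entry, two function
spaces.**  Hypotheses: the (3.42)_n two-space majorant B₀P(y)e^{−δ₀d(y,y′)} of T (P ≥ 0; P = (L^jη)², L^jη, L^jη, 1
for the four entries), (2.60) and (2.61) (at 1 − α) of [4] in pv08's typed form for the transported geometry, L ≥ 1,
η > 0, and |γ|·log L ≤ αδ₀RM.  Conclusion: if |λ(x)| ≤ (L^{j′}η)^γ N on every Δ(y′) (|λ|_{(γ)} ≤ N), then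
|(Tλ)(v)| ≤ B₀c₁(1−α)L^{|γ|}·P(y)(L^jη)^γ·N for v in the block of y ∈ Λ_j — i.e. |Tλ|_{(p+γ)} ≤ B₀(γ)|λ|_{(γ)} with
**B₀(γ) = B₀c₁(1−α)L^{|γ|}** (any 0 < α < 1 admissible in Lemma 2.1).
[cite: Balaban1985BackgroundPropagators, (3.47) p.398; Balaban1984PropagatorsII, Lemma 2.1 (2.60)–(2.61) p.234] -/
theorem glob347_of_342_weighted (blkX : X → g.Site) (blkY : Y → g.Site) (d : ℕ) (δ₀ α B₀ γ N : ℝ)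
    (P : g.Site → ℝ) (hB₀ : 0 ≤ B₀) (hP : ∀ y, 0 ≤ P y) (hN : 0 ≤ N) (hL : 1 ≤ g.L) (hη : 0 < g.eta)
    (hsize : |γ| * Real.log g.L ≤ α * δ₀ * R * g.M)
    (h260 : Ineq260 (B9Thm34Ext.toB6 g R H) δ₀ α) (h261 : Ineq261 d (B9Thm34Ext.toB6 g R H) δ₀ (1 - α))
    {T : (X → ℝ) →ₗ[ℝ] (Y → ℝ)}
    (h342 : HasMajorantHom (g := B9Thm34Ext.toB6 g R H) blkX blkY T
      (fun a b => B₀ * P a * Real.exp (-(δ₀ * g.dist a b))))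
    (μ : X → ℝ) (hμ : ∀ x, |μ x| ≤ (g.len (blkX x)) ^ γ * N) (v : Y) :
    |T μ v| ≤ B₀ * B6.c1 d δ₀ (1 - α) * g.L ^ |γ| * P (blkY v) * (g.len (blkY v)) ^ γ * N := by
  have hL0 : 0 < g.L := lt_of_lt_of_le one_pos hL
  have hST : ScaleTransfer g δ₀ α (g.L ^ |γ|) (fun y => (g.len y) ^ γ) :=
    scaleTransfer_of_260 g δ₀ α (Real.exp (-(α * δ₀ * R * g.M))) (g.L ^ |γ|) (fun y => (g.len y) ^ γ)
      (fun y y' => Nat.dist (g.scale y) (g.scale y')) (Real.exp_nonneg _) (one_le_rpow_abs g.L γ hL)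
      (rpow_abs_mul_exp_le_one g.L γ _ hL0 hsize) (weight_nonneg g hL0 hη γ)
      (h260_nat_of_Ineq260 g R H δ₀ α h260) (fun y y' => weight_ratio g hL hη γ y y')
  exact glob347_of_342_hom (R := R) (H := H) blkX blkY d δ₀ α B₀ (g.L ^ |γ|) N P (fun y => (g.len y) ^ γ)
    hB₀ hP (weight_nonneg g hL0 hη γ) hN h261 hST h342 μ hμ v

/-- The same conclusion with the two powers of L^jη merged into the printed exponent: |(Tλ)(v)| ≤
B₀c₁(1−α)L^{|γ|}·(L^jη)^{[2,1,1,0]_n+γ}·N for the entry n with P = [(L^jη)², L^jη, L^jη, 1]_n = `B9.pref4 (L^jη) n`.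
[cite: Balaban1985BackgroundPropagators, (3.47) p.398] -/
theorem glob347_of_342_weighted_rpow (blkX : X → g.Site) (blkY : Y → g.Site) (d : ℕ) (δ₀ α B₀ γ N : ℝ)
    (n : Fin 4) (hB₀ : 0 ≤ B₀) (hN : 0 ≤ N) (hL : 1 ≤ g.L) (hη : 0 < g.eta)
    (hsize : |γ| * Real.log g.L ≤ α * δ₀ * R * g.M)
    (h260 : Ineq260 (B9Thm34Ext.toB6 g R H) δ₀ α) (h261 : Ineq261 d (B9Thm34Ext.toB6 g R H) δ₀ (1 - α))
    {T : (X → ℝ) →ₗ[ℝ] (Y → ℝ)}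
    (h342 : HasMajorantHom (g := B9Thm34Ext.toB6 g R H) blkX blkY T
      (fun a b => B₀ * B9.pref4 (g.len a) n * Real.exp (-(δ₀ * g.dist a b))))
    (μ : X → ℝ) (hμ : ∀ x, |μ x| ≤ (g.len (blkX x)) ^ γ * N) (v : Y) :
    |T μ v| ≤ B₀ * B6.c1 d δ₀ (1 - α) * g.L ^ |γ| *
      (g.len (blkY v)) ^ ((![2, 1, 1, 0] : Fin 4 → ℝ) n + γ) * N := by
  have hL0 : 0 < g.L := lt_of_lt_of_le one_pos hL
  have h := glob347_of_342_weighted (R := R) (H := H) blkX blkY d δ₀ α B₀ γ N (fun y => B9.pref4 (g.len y) n)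
    hB₀ (fun y => pref4_nonneg _ (len_pos g hL0 hη y).le n) hN hL hη hsize h260 h261 h342 μ hμ v
  rw [← pref4_mul_rpow _ γ (len_pos g hL0 hη _) n]
  simpa [mul_assoc] using h

/-- **(3.47), ALL FOUR ENTRIES, for γ in the printed compact set [−4, 4].**  A family of operators T_n (n = 1, …, 4:
G′, ∇_UG′, G′∇\*_U, Δ_UG′) between carriers X_n → Y_n (sites/bonds as appropriate, block maps `bX n`, `bY n`) with the
(3.42) two-space majorants B₀·[(L^jη)², L^jη, L^jη, 1]_n·e^{−δ₀d(y,y′)}; Lemma 2.1 of [4] ((2.60), (2.61) at 1 − α) for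
the geometry; L ≥ 1, η > 0; and the ONE size condition 4·log L ≤ αδ₀RM.  Then for every γ ∈ [−4, 4] and every λ with
|λ|_{(γ)} ≤ N:  |(T_nλ)(v)| ≤ B₀c₁(1−α)L⁴·[(L^jη)², L^jη, L^jη, 1]_n·(L^jη)^γ·N for v in the block of y ∈ Λ_j — the four
global inequalities |G′λ|_{(2+γ)}, |∇_UG′λ|_{(1+γ)}, |G′∇\*_Uλ|_{(1+γ)}, |Δ_UG′λ|_{(γ)} ≤ B₀(γ)|λ|_{(γ)} with ONE constant
B₀c₁(1−α)L⁴ on the compact set ("dependent on d and L only", as in Theorem 3.1).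
[cite: Balaban1985BackgroundPropagators, Thm 3.1 (3.42) p.397 + (3.47) p.398; Balaban1984PropagatorsII, Lemma 2.1 p.234] -/
theorem glob347_allEntries (Xc Yc : Fin 4 → Type) (bX : ∀ n, Xc n → g.Site) (bY : ∀ n, Yc n → g.Site)
    (d : ℕ) (δ₀ α B₀ : ℝ) (hB₀ : 0 ≤ B₀) (hL : 1 ≤ g.L) (hη : 0 < g.eta)
    (hsize : 4 * Real.log g.L ≤ α * δ₀ * R * g.M)
    (h260 : Ineq260 (B9Thm34Ext.toB6 g R H) δ₀ α) (h261 : Ineq261 d (B9Thm34Ext.toB6 g R H) δ₀ (1 - α))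
    (T : ∀ n, (Xc n → ℝ) →ₗ[ℝ] (Yc n → ℝ))
    (h342 : ∀ n, HasMajorantHom (g := B9Thm34Ext.toB6 g R H) (bX n) (bY n) (T n)
      (fun a b => B₀ * B9.pref4 (g.len a) n * Real.exp (-(δ₀ * g.dist a b))))
    (n : Fin 4) (γ : ℝ) (hγ : |γ| ≤ 4) (N : ℝ) (hN : 0 ≤ N)
    (μ : Xc n → ℝ) (hμ : ∀ x, |μ x| ≤ (g.len (bX n x)) ^ γ * N) (v : Yc n) :
    |T n μ v| ≤ B₀ * B6.c1 d δ₀ (1 - α) * g.L ^ (4 : ℝ) *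
      B9.pref4 (g.len (bY n v)) n * (g.len (bY n v)) ^ γ * N := by
  have hL0 : 0 < g.L := lt_of_lt_of_le one_pos hL
  obtain ⟨hsz, hL4⟩ := size_condition_compact g.L γ _ hL hγ hsize
  have h := glob347_of_342_weighted (R := R) (H := H) (bX n) (bY n) d δ₀ α B₀ γ N
    (fun y => B9.pref4 (g.len y) n) hB₀ (fun y => pref4_nonneg _ (len_pos g hL0 hη y).le n) hN hL hη hsz
    h260 h261 (h342 n) μ hμ v
  refine h.trans ?_
  have hc1 : 0 ≤ B₀ * B6.c1 d δ₀ (1 - α) := -- c₁(1−α) ≥ the (2.61) row sum at y(v) ≥ 0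
    mul_nonneg hB₀ ((Finset.sum_nonneg fun _ _ => Real.exp_nonneg _).trans (h261 (bY n v)))
  have hrest : 0 ≤ B9.pref4 (g.len (bY n v)) n * (g.len (bY n v)) ^ γ * N :=
    mul_nonneg (mul_nonneg (pref4_nonneg _ (len_pos g hL0 hη _).le n) (weight_nonneg g hL0 hη γ _)) hN
  have := mul_le_mul_of_nonneg_left hL4 hc1
  calc B₀ * B6.c1 d δ₀ (1 - α) * g.L ^ |γ| * B9.pref4 (g.len (bY n v)) n * (g.len (bY n v)) ^ γ * N
      = (B₀ * B6.c1 d δ₀ (1 - α) * g.L ^ |γ|) * (B9.pref4 (g.len (bY n v)) n * (g.len (bY n v)) ^ γ * N) := by ring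
    _ ≤ (B₀ * B6.c1 d δ₀ (1 - α) * g.L ^ (4 : ℝ)) * (B9.pref4 (g.len (bY n v)) n * (g.len (bY n v)) ^ γ * N) :=
        mul_le_mul_of_nonneg_right this hrest
    _ = B₀ * B6.c1 d δ₀ (1 - α) * g.L ^ (4 : ℝ) * B9.pref4 (g.len (bY n v)) n * (g.len (bY n v)) ^ γ * N := by ring

end Assembled

end Literature.MathematicalPhysics.QuantumFieldTheory.Balaban1983to89.B9Ineq347AllEntries
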